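import Summits.Schanuel.Schanuel.Theorems.RootDecomp1BMovingZero13
import Literature.Analysis.Complex.AnalyticCover
import Literature.Analysis.Complex.OsgoodProofs
import Literature.Geometry.Kaehler.AnalyticSetOpenProjection
import Literature.Geometry.Kaehler.AnalyticSetFiniteMaps
import Literature.Geometry.Kaehler.AnalyticSetZeroDimensional
import Literature.Geometry.Kaehler.AnalyticSetIntersectionDimension

/-!
# RootDecomp1BMovingZero — lens 4, generation 37 «SUB-PIECE A UNCONDITIONAL» (lane B-R24 (a)): the two print-fact binders `RoucheMaps` (A1) and `IsolatedZeroLowerBound` (A2) of part 04 DISCHARGED by sorry-free proofs BY NAME (`roucheMaps_holds`, `isolatedZeroLowerBound_holds`) from the tree SCV library; `analyticMovingZero_holds` binder-free; the (1|ρ) cell modulo five named inputs — continuation (RootDecomp1BMovingZero14): §1 FACT A2 `isolatedZeroLowerBound_holds` DISCHARGED (shadow equations of the graph)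

(lens-4 g37 HOME kernel PieceADischarge.lean dc12d931…, 549 l, imports tree MovingZero13 + Literature AnalyticCover / OsgoodProofs / AnalyticSetOpenProjection / AnalyticSetFiniteMaps / AnalyticSetZeroDimensional / AnalyticSetIntersectionDimension; CLAIM L1976, critic ACK + CHECKLIST B-g37 L1979, NODE L2000 / REQUEST L2001, critic VERDICT L2007 (crit g8: CLEARED — THEOREM ×2, one per named def : Prop discharged BY NAME; lens-4 tally THEOREM ×4 + CELL ×2; PORT GO `--supports stmt-Schanuel-24622`, kind proof); port by census-1 gen 17 as `RootDecomp1BMovingZero14`–`15`: 14 = §1 FACT A2 `isolatedZeroLowerBound_holds : IsolatedZeroLowerBound` (canonical SHADOW EQUATIONS of the graph system via `Literature.Analysis.Complex.SCV.exists_shadow_equation` + one-variable order + local Lipschitz of the shadow); 15 = §2 FACT A1 `roucheMaps_holds : RoucheMaps` (finiteness + isolation on the compact ball ∩ zero set, persistence by Remmert open projection, continuity method along the straight-line homotopy) + §3 READ-OUTS `analyticMovingZero_holds : AnalyticMovingZero`, `approxOfIsolated_of_isolatedPointBound`, `movingZeroApprox_of_three_facts : CurveSelection → AxRankBoundLaurent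 → IsolatedPointBound → ∀ ρ, MovingZeroApprox ρ`, `four_le_polarDeg_one_of_three_facts` (+ swap / hyper / ρ_T) — the cell's named inputs drop from SEVEN to FIVE.
PORT EDITS: the axiom-guard section and `import HarnessLib` (unused) dropped; `set_option linter.dupNamespace false` dropped; statements and proofs verbatim (theorem types = the tree defs BY NAME). `--supports stmt-Schanuel-24622`; no census credit carried; rung 0 — nothing here proves Schanuel or 32406.)
-/

noncomputable section

open Complex Filter Topology Metric Set
open Literature.Analysis.Complex.SCV (IsZeroSetAt)
open Literature.Geometry.Kaehler.SCV (IsRegPt regLocus)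

namespace Summit.Schanuel.Schanuel.Theorems.RootDecomp1BMovingZero

/-!
# RootDecomp1BMovingZero — lens 4, generation 37 «SUB-PIECE A UNCONDITIONAL»: BOTH named print inputs of
# SUB-PIECE A — `RoucheMaps` (FACT A1) and `IsolatedZeroLowerBound` (FACT A2) — DISCHARGED by sorry-free proofs
# of the SAME statements BY NAME (lane B-R24 (a), critic VERDICT L1957; input list B-R23 (ii)(a), L1894)

HOME kernel of lens 4, g37 (NOTE/CLAIM L1976).  Imports ONLY accepted·committed tree modules: the cell's part
`RootDecomp1BMovingZero13` (transitively 01–12: the two `def`s discharged here live in part 04, l.196 / l.206,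
and are used BY NAME — no copy, no primed variant, no restatement) and the tree's several-complex-variables /
analytic-set library `Literature.Analysis.Complex.{AnalyticCover, OsgoodProofs}`,
`Literature.Geometry.Kaehler.{AnalyticSetOpenProjection, AnalyticSetFiniteMaps, AnalyticSetZeroDimensional,
AnalyticSetIntersectionDimension}` (all PROVED, sorry-free; Chirka 1989 Ch. 1–3, Fischer 1976 §3 formalised).
0 `sorry`, no new `def`, no new named fact, no `instance`/`notation`; axioms `propext, Classical.choice, Quot.sound`
(guards §4).

## What is proved (all theorems in `namespace Summit.Schanuel.Schanuel.Theorems.RootDecomp1BMovingZero`)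

* §1 **`isolatedZeroLowerBound_holds : IsolatedZeroLowerBound`** (FACT A2, part 04 l.206: a holomorphic
  `f : ℂ² → ℂ²` with an isolated zero at `w₀` satisfies `c ‖w − w₀‖ᴺ ≤ ‖f w‖` near `w₀`).  PROOF: for each fibre
  coordinate `i`, the canonical SHADOW EQUATION of the isolated fibre point `w₀` of the GRAPH system
  `f(w) − y = 0` over the parameter `y ∈ ℂ²` (`Literature.Analysis.Complex.SCV.exists_shadow_equation`,
  [Chirka1989, §3.2 Thm.; §3.6]) is a holomorphic `F(y, t)` with `F(f w, wᵢ) = 0` near `w₀` and `F(0, ·) ≢ 0`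
  near `w₀ᵢ`; one-variable vanishing order gives `|F(0, t)| ≥ c₁ |t − w₀ᵢ|ⁿ`
  (`exists_pow_mul_le_norm_of_not_eventually_zero`, Mathlib `AnalyticAt.exists_eventuallyEq_pow_smul_nonzero_iff`)
  and the local Lipschitz property of `F` (`ContDiffAt.exists_lipschitzOnWith`, analyticity of `F` by the tree's
  Osgood lemma `SCV.analyticAt_of_differentiableOn`) gives `|F(0, wᵢ)| = |F(0, wᵢ) − F(f w, wᵢ)| ≤ K ‖f w‖`;
  hence `c |wᵢ − w₀ᵢ|ⁿ ≤ ‖f w‖` per coordinate (`exists_coord_pow_mul_le_norm`, any linear chart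
  `ℂ² ≃L ℂ × ℂ`), and `‖w − w₀‖ = max_i |wᵢ − w₀ᵢ|` (sup norm) finishes with `N = max nᵢ`, `c = min cᵢ`.
* §2 **`roucheMaps_holds : RoucheMaps`** (FACT A1, part 04 l.196: Rouché for holomorphic self-maps of the
  bidisc, multiplicity-free form with finiteness).  PROOF: (i) `finite_zeros_ball` — zeros in the ball of a map
  analytic near the closed ball and zero-free on the sphere form a compact set cut out by two holomorphic
  equations near each point, hence FINITE with all points ISOLATED
  (`Literature.Geometry.Kaehler.SCV.finite_of_isCompact_of_isZeroSetAt`, `…eventually_notMem_of_isCompact_…`,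
  [Chirka1989, §3.3 Prop. 1]); (ii) `eventually_exists_zero_nhds` — PERSISTENCE of an isolated zero `w₁` of
  `H(s₀, ·)` in a holomorphic family: REMMERT'S OPEN MAPPING THEOREM
  (`Literature.Geometry.Kaehler.SCV.image_inter_mem_nhds_of_fibre`, [Fischer1976, §3.9 Prop.]) for
  `Ψ(s, w) = (s, H(s, w))` on a ball of `ℂ × ℂ²` (pure dimension `3`, `m = 3`, `r = 0`), whose fibre through
  `(s₀, w₁)` is the isolated point `{(s₀, w₁)}`, regular of codimension `3`
  (`isRegularPointOfCodim_finrank_of_inter_subset_singleton` + `isRegularPointOfCodim_iff_isRegPt` +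
  `IsRegPt.codim_unique`, [Chirka1989, §2.3]); (iii) CONTINUITY METHOD along `H(s, w) = f w + s (g w − f w)`,
  `s ∈ [0, 1]`: no zero on the sphere (`‖f − g‖ < ‖f‖` there), the set of `s` carrying a zero in the open ball
  contains `0` (`f w₀ = 0`), is closed on `[0, 1]` (projection of a compact set) and right-open ((ii) at a zero
  isolated by (i)), so it is `[0, 1]` (Mathlib `IsClosed.Icc_subset_of_forall_mem_nhdsWithin`); `H(1, ·) = g`.
* §3 READ-OUTS (compositions with the tree, every remaining input NAMED): `analyticMovingZero_holds :
  AnalyticMovingZero` (SUB-PIECE A now HYPOTHESIS-FREE: part 04's `analyticMovingZero_of_facts` with both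
  inputs discharged); `approxOfIsolated_of_isolatedPointBound : IsolatedPointBound → ∀ ρ, ApproxOfIsolated ρ`;
  `movingZeroApprox_of_three_facts : CurveSelection → AxRankBoundLaurent → IsolatedPointBound → ∀ ρ,
  MovingZeroApprox ρ` (the cell's MZ input now modulo THREE named inputs, of which `AxRankBoundLaurent` is the
  tree-PROVED Ax 1971 by name — i.e. modulo the two PRINT facts `CurveSelection` (T) and `IsolatedPointBound` (B));
  the cell theorems `four_le_polarDeg_one_of_three_facts` (X(2) at `(1, ρ)` for every `ρ` of exponential
  Liouville order 8), `…_swap_…`, `…_hyper_…`, `…_rhoT_…` (the NON-hyper-Liouville member `towerNumber 9`).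

Fact budget of the moving-zero cell after g37: T 1 (`CurveSelection`) · A 0 (was 2) · B 1 (`IsolatedPointBound`)
+ Ax (proved).  [cite: Chirka1989, §2.3, §3.2–3.3, §3.6, §3.8, §10.3 Thm. 1] [cite: Fischer1976, §3.9 Prop.]
-/

/-! ## §1  FACT A2 `IsolatedZeroLowerBound` DISCHARGED — shadow equations of the graph -/

section FactA2

/-- **Finite vanishing order gives a power lower bound** (one variable): an analytic `G` not identically
zero near `t₀` satisfies `c · |t − t₀|ⁿ ≤ |G t|` near `t₀` for some `c > 0`, `n ∈ ℕ`. [folklore] -/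
theorem exists_pow_mul_le_norm_of_not_eventually_zero {G : ℂ → ℂ} {t₀ : ℂ} (hG : AnalyticAt ℂ G t₀)
    (hne : ¬ ∀ᶠ t in 𝓝 t₀, G t = 0) :
    ∃ (c : ℝ) (n : ℕ), 0 < c ∧ ∀ᶠ t in 𝓝 t₀, c * ‖t - t₀‖ ^ n ≤ ‖G t‖ := by
  obtain ⟨n, g, hg, hg0, hev⟩ := hG.exists_eventuallyEq_pow_smul_nonzero_iff.mpr hne
  have hgpos : 0 < ‖g t₀‖ := norm_pos_iff.mpr hg0
  have hpos : 0 < ‖g t₀‖ / 2 := by linarith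
  have hgc : ∀ᶠ t in 𝓝 t₀, ‖g t₀‖ / 2 ≤ ‖g t‖ := by
    have h1 : ∀ᶠ t in 𝓝 t₀, dist (g t) (g t₀) < ‖g t₀‖ / 2 :=
      (Metric.tendsto_nhds.1 hg.continuousAt.tendsto) _ hpos
    filter_upwards [h1] with t ht
    rw [dist_eq_norm] at ht
    have h2 := norm_sub_norm_le (g t₀) (g t)
    rw [norm_sub_rev] at h2
    linarith
  refine ⟨‖g t₀‖ / 2, n, hpos, ?_⟩
  filter_upwards [hev, hgc] with t ht hgt
  rw [ht, norm_smul, norm_pow]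
  calc ‖g t₀‖ / 2 * ‖t - t₀‖ ^ n = ‖t - t₀‖ ^ n * (‖g t₀‖ / 2) := by ring
    _ ≤ ‖t - t₀‖ ^ n * ‖g t‖ := by gcongr

/-- **Per-coordinate lower bound at an isolated zero** (in a linear chart `eL : ℂ² ≃ ℂ × ℂ`): if `f` is analytic
at `w₀`, `f w₀ = 0` and `w₀` is an isolated zero, then for each fibre coordinate `i`,
`c · |wᵢ − w₀ᵢ|ⁿ ≤ ‖f w‖` near `w₀`.  The shadow of the graph `{(f w, w)}` on the `(y, wᵢ)`-plane lies in the
zero set of a holomorphic `F` with `F(0, ·) ≢ 0` near `w₀ᵢ` [Chirka1989, §3.2 Thm.; §3.6]; then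
`|F(0, wᵢ)| = |F(0, wᵢ) − F(f w, wᵢ)| ≤ K ‖f w‖` (Lipschitz) and `|F(0, wᵢ)| ≥ c |wᵢ − w₀ᵢ|ⁿ` (order).
[cite: Chirka1989, §3.2 Thm.; §3.6] -/
theorem exists_coord_pow_mul_le_norm (eL : (Fin 2 → ℂ) ≃L[ℂ] ℂ × ℂ) (f : ℂ × ℂ → ℂ × ℂ) (w₀ : ℂ × ℂ)
    (hf : AnalyticAt ℂ f w₀) (h0 : f w₀ = 0) (hiso : ∀ᶠ w in 𝓝[≠] w₀, f w ≠ 0) (i : Fin 2) :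
    ∃ (c : ℝ) (n : ℕ), 0 < c ∧ ∀ᶠ w in 𝓝 w₀, c * ‖eL.symm w i - eL.symm w₀ i‖ ^ n ≤ ‖f w‖ := by
  -- the graph equations `Φ (y, v) = eL⁻¹ (f (eL v)) − eL⁻¹ y` on `W = ℂ² × {v | f analytic at eL v}`
  set Φ : (ℂ × ℂ) × (Fin 2 → ℂ) → (Fin 2 → ℂ) := fun p => eL.symm (f (eL p.2)) - eL.symm p.1 with hΦ
  set W : Set ((ℂ × ℂ) × (Fin 2 → ℂ)) := univ ×ˢ (eL ⁻¹' {x | AnalyticAt ℂ f x}) with hW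
  have hWo : IsOpen W := isOpen_univ.prod ((isOpen_analyticAt ℂ f).preimage eL.continuous)
  have haW : (((0 : ℂ × ℂ), eL.symm w₀) : (ℂ × ℂ) × (Fin 2 → ℂ)) ∈ W := by
    refine ⟨mem_univ _, ?_⟩
    show AnalyticAt ℂ f (eL (eL.symm w₀))
    rw [eL.apply_symm_apply]
    exact hf
  have hΦd : DifferentiableOn ℂ Φ W := by
    intro p hp
    have hp2 : AnalyticAt ℂ f (eL p.2) := hp.2
    have h1 : DifferentiableAt ℂ (fun p : (ℂ × ℂ) × (Fin 2 → ℂ) => eL.symm (f (eL p.2))) p :=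
      eL.symm.differentiableAt.comp p
        (hp2.differentiableAt.comp p (eL.differentiableAt.comp p differentiableAt_snd))
    have h2 : DifferentiableAt ℂ (fun p : (ℂ × ℂ) × (Fin 2 → ℂ) => eL.symm p.1) p :=
      eL.symm.differentiableAt.comp p differentiableAt_fst
    exact (h1.sub h2).differentiableWithinAt
  -- isolation of the fibre point `eL⁻¹ w₀` of `Φ (0, ·)`
  have hiso' : ∀ᶠ v in 𝓝[≠] (eL.symm w₀), Φ ((0 : ℂ × ℂ), v) ≠ 0 := by
    have ht : Tendsto (⇑eL) (𝓝[≠] (eL.symm w₀)) (𝓝[≠] w₀) := by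
      refine tendsto_nhdsWithin_iff.2 ⟨?_, ?_⟩
      · have h1 : Tendsto (⇑eL) (𝓝 (eL.symm w₀)) (𝓝 (eL (eL.symm w₀))) :=
          eL.continuous.continuousAt.tendsto
        rw [eL.apply_symm_apply] at h1
        exact h1.mono_left nhdsWithin_le_nhds
      · refine eventually_nhdsWithin_of_forall fun v hv => ?_
        intro h
        apply hv
        have h' : eL.symm (eL v) = eL.symm w₀ := by rw [show eL v = w₀ from h]
        simpa using h'
    have h2 : ∀ᶠ v in 𝓝[≠] (eL.symm w₀), f (eL v) ≠ 0 := ht.eventually hiso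
    refine h2.mono fun v hv => ?_
    show eL.symm (f (eL v)) - eL.symm 0 ≠ 0
    rw [map_zero, sub_zero]
    intro h
    apply hv
    simpa using congrArg eL h
  obtain ⟨V, hVo, haV, -, O, hOo, haO, F, hFd, hFne, hFzero⟩ :=
    Literature.Analysis.Complex.SCV.exists_shadow_equation (a := ((0 : ℂ × ℂ), eL.symm w₀)) hWo hΦd haW
      hiso' i
  -- notation: `t₀ = (eL⁻¹ w₀) i`; the slice `G t = F (0, t)`
  have haO' : (((0 : ℂ × ℂ), eL.symm w₀ i) : (ℂ × ℂ) × ℂ) ∈ O := haO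
  have hGne : ¬ ∀ᶠ t in 𝓝 (eL.symm w₀ i), F (0, t) = 0 := fun h => hFne h
  have hOslice : IsOpen {t : ℂ | (((0 : ℂ × ℂ), t) : (ℂ × ℂ) × ℂ) ∈ O} :=
    hOo.preimage (continuous_const.prodMk continuous_id)
  have hGd : DifferentiableOn ℂ (fun t : ℂ => F (0, t)) {t : ℂ | (((0 : ℂ × ℂ), t) : (ℂ × ℂ) × ℂ) ∈ O} := by
    intro t ht
    have hFt : DifferentiableAt ℂ F ((0 : ℂ × ℂ), t) := (hFd _ ht).differentiableAt (hOo.mem_nhds ht)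
    exact (hFt.comp t ((differentiableAt_const _).prodMk differentiableAt_id)).differentiableWithinAt
  have hGa : AnalyticAt ℂ (fun t : ℂ => F (0, t)) (eL.symm w₀ i) :=
    hGd.analyticAt (hOslice.mem_nhds haO')
  obtain ⟨c₁, n, hc₁, hlow⟩ := exists_pow_mul_le_norm_of_not_eventually_zero hGa hGne
  -- local Lipschitz bound of the shadow function near `(0, t₀)`
  have hFa : AnalyticAt ℂ F (((0 : ℂ × ℂ), eL.symm w₀ i) : (ℂ × ℂ) × ℂ) :=
    Literature.Analysis.Complex.SCV.analyticAt_of_differentiableOn hFd hOo haO'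
  obtain ⟨K, T, hT, hlip⟩ := (hFa.contDiffAt (n := 1)).exists_lipschitzOnWith
  -- everything happens near `w₀`
  have hf0 : Tendsto f (𝓝 w₀) (𝓝 0) := by simpa [h0] using hf.continuousAt.tendsto
  have hcoord : Tendsto (fun w => eL.symm w i) (𝓝 w₀) (𝓝 (eL.symm w₀ i)) :=
    ((continuous_apply i).comp eL.symm.continuous).continuousAt.tendsto
  have hev1 : ∀ᶠ w in 𝓝 w₀, ((f w, eL.symm w) : (ℂ × ℂ) × (Fin 2 → ℂ)) ∈ V :=
    (hf0.prodMk_nhds eL.symm.continuous.continuousAt.tendsto).eventually (hVo.mem_nhds haV)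
  have hev2 : ∀ᶠ w in 𝓝 w₀, ((f w, eL.symm w i) : (ℂ × ℂ) × ℂ) ∈ T :=
    (hf0.prodMk_nhds hcoord).eventually hT
  have hev3 : ∀ᶠ w in 𝓝 w₀, (((0 : ℂ × ℂ), eL.symm w i) : (ℂ × ℂ) × ℂ) ∈ T :=
    (tendsto_const_nhds.prodMk_nhds hcoord).eventually hT
  have hev4 : ∀ᶠ w in 𝓝 w₀, c₁ * ‖eL.symm w i - eL.symm w₀ i‖ ^ n ≤ ‖F (0, eL.symm w i)‖ :=
    hcoord.eventually hlow
  have hK : (0 : ℝ) < K + 1 := by positivity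
  refine ⟨c₁ / (K + 1), n, by positivity, ?_⟩
  filter_upwards [hev1, hev2, hev3, hev4] with w h1 h2 h3 h4
  -- the shadow equation at the graph point `(f w, eL⁻¹ w)`
  have hzero : F (f w, eL.symm w i) = 0 := by
    have hΦw : Φ (f w, eL.symm w) = 0 := by simp [hΦ]
    exact (hFzero _ h1 hΦw).2
  -- Lipschitz: `|F (0, s)| = |F (0, s) − F (f w, s)| ≤ K ‖f w‖`
  have hdist : dist (((0 : ℂ × ℂ), eL.symm w i) : (ℂ × ℂ) × ℂ) (f w, eL.symm w i) ≤ ‖f w‖ := by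
    rw [Prod.dist_eq, max_le_iff]
    constructor
    · simp
    · simp
  have hlipw : ‖F (0, eL.symm w i)‖ ≤ K * ‖f w‖ := by
    have h := hlip.dist_le_mul _ h3 _ h2
    rw [hzero, dist_zero_right] at h
    exact h.trans (by gcongr)
  rw [div_mul_eq_mul_div, div_le_iff₀ hK]
  calc c₁ * ‖eL.symm w i - eL.symm w₀ i‖ ^ n ≤ ‖F (0, eL.symm w i)‖ := h4
    _ ≤ K * ‖f w‖ := hlipw
    _ ≤ ‖f w‖ * (K + 1) := by nlinarith [norm_nonneg (f w), K.coe_nonneg]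

/-- **`IsolatedZeroLowerBound` holds** (the tree's named input of SUB-PIECE A, part 04 l.206, discharged): a
holomorphic `f : ℂ² → ℂ²` with an isolated zero at `w₀` satisfies `‖f w‖ ≥ c ‖w − w₀‖ᴺ` near `w₀`
(finite Łojasiewicz exponent).  Both coordinates of `w − w₀` are bounded through the shadow equations
(`exists_coord_pow_mul_le_norm` in the chart `ContinuousLinearEquiv.finTwoArrow`), and `‖w − w₀‖` is their
maximum. [cite: Chirka1989, §3.2 Thm.; §3.6] -/
theorem isolatedZeroLowerBound_holds : IsolatedZeroLowerBound := by
  intro f w₀ hf h0 hiso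
  obtain ⟨c₀, n₀, hc₀, h₀⟩ :=
    exists_coord_pow_mul_le_norm (ContinuousLinearEquiv.finTwoArrow ℂ ℂ) f w₀ hf h0 hiso 0
  obtain ⟨c₁, n₁, hc₁, h₁⟩ :=
    exists_coord_pow_mul_le_norm (ContinuousLinearEquiv.finTwoArrow ℂ ℂ) f w₀ hf h0 hiso 1
  refine ⟨min c₀ c₁, max n₀ n₁, lt_min hc₀ hc₁, ?_⟩
  have hsmall : ∀ᶠ w in 𝓝 w₀, ‖w - w₀‖ < 1 := by
    filter_upwards [Metric.ball_mem_nhds w₀ one_pos] with w hw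
    rwa [mem_ball, dist_eq_norm] at hw
  filter_upwards [h₀, h₁, hsmall] with w hw₀ hw₁ hws
  simp only [ContinuousLinearEquiv.finTwoArrow_symm_apply, Matrix.cons_val_zero,
    Matrix.cons_val_one] at hw₀ hw₁
  have hnorm : ‖w - w₀‖ = max ‖w.1 - w₀.1‖ ‖w.2 - w₀.2‖ := by
    rw [Prod.norm_def, Prod.fst_sub, Prod.snd_sub]
  have hle1 : ‖w - w₀‖ ≤ 1 := hws.le
  rcases le_total ‖w.1 - w₀.1‖ ‖w.2 - w₀.2‖ with h | h
  · have hm : ‖w - w₀‖ = ‖w.2 - w₀.2‖ := by rw [hnorm, max_eq_right h]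
    calc min c₀ c₁ * ‖w - w₀‖ ^ max n₀ n₁ ≤ c₁ * ‖w - w₀‖ ^ n₁ :=
          mul_le_mul (min_le_right _ _)
            (pow_le_pow_of_le_one (norm_nonneg _) hle1 (le_max_right _ _)) (by positivity) hc₁.le
      _ = c₁ * ‖w.2 - w₀.2‖ ^ n₁ := by rw [hm]
      _ ≤ ‖f w‖ := hw₁
  · have hm : ‖w - w₀‖ = ‖w.1 - w₀.1‖ := by rw [hnorm, max_eq_left h]
    calc min c₀ c₁ * ‖w - w₀‖ ^ max n₀ n₁ ≤ c₀ * ‖w - w₀‖ ^ n₀ :=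
          mul_le_mul (min_le_left _ _)
            (pow_le_pow_of_le_one (norm_nonneg _) hle1 (le_max_left _ _)) (by positivity) hc₀.le
      _ = c₀ * ‖w.1 - w₀.1‖ ^ n₀ := by rw [hm]
      _ ≤ ‖f w‖ := hw₀

end FactA2

end Summit.Schanuel.Schanuel.Theorems.RootDecomp1BMovingZero

end
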